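import Summits.BirchSwinnertonDyer.BirchSwinnertonDyer.Theorems.ManinLocalTwoThreeQuadraticTwistConductorUnramified
import Literature.NumberTheory.EllipticCurves.QuadraticTwistMinimalModelProofs
import Literature.NumberTheory.EllipticCurves.QuadraticTwistIntegralModel
import Literature.NumberTheory.EllipticCurves.QuadraticTwistTateFormTwoProofs
import Literature.NumberTheory.EllipticCurves.RootNumberSmulProofs
import Literature.NumberTheory.EllipticCurves.SzpiroLocalDataProofs
import Literature.NumberTheory.DiophantineGeometry.ConductorAdditiveProofs
import Literature.NumberTheory.DiophantineGeometry.ConductorExponentZeroProofs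
import Literature.NumberTheory.DiophantineGeometry.ConductorMultiplicativeProofs
import Literature.NumberTheory.DiophantineGeometry.ConductorFactorizationProofs
import Literature.NumberTheory.DiophantineGeometry.ConductorRingOfIntegersProofs
import HarnessLib

/-!
# A quadratic twist UNRAMIFIED at an odd place keeps the conductor exponent, the Kodaira symbol and
# the reduction type there — the general «`q ∤ d`, `q` odd» lemma, and its reading on the C3 core at `3`
# (route `ManinLocalTwoThree`, cell bsd-f2-manin; crux C3 `ManinPrimeToThreeAtNine` stmt-BirchSwinnertonDyer-22968;
# prover seat p3 gen 13, answering the C3 LEAD's 08:03:46Z ask «a twist unramified at v keeps f_v — beyond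
# d = −1 / v ≠ 2?»)

THE POINT.  Companion of the LEAD's `ManinLocalTwoThreeQuadraticTwistConductorUnramified.lean` (p708140, landed minutes
earlier: `conductorExponent_quadraticTwist_eq_of_not_dvd` — `f_v(W ⊗ d) = f_v(W)` at an odd place `v ∤ d` — and its reading
at `3`), which this file IMPORTS and extends to the Kodaira symbol, the reduction type, the `𝓞 ℚ`-place and factorisation
currencies, and the full list of C3-core binders.  Before, the tree had the unramified-twist invariance only for
`d ∈ {−1, 2, −2}` (`maninLocalTwoThree_conductorExponent_quadraticTwist_eq_of_ne_two`) and, in factorisation currency, for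
`d ≡ 1 (mod 4)` (`factorization_conductorNorm_quadraticTwist_eq_of_not_dvd`).  The
C3 skeleton v19 (v18 read on p2's C3 CORE `{9 ∣ N} ∩ {ord₃ j > 0} ∩ {K₃ pot. good} ∩ {W ⊗ (−3) additive at 3}`) transports
the core binders along the COPRIME twist partners `A ⊗ q*` (`q ≠ 2, 3`) of the certificate branch of
`noRationalThreeTorsionOrbitMinimalResidual_of_coprimeIsolated`; for that one needs, at the place `3`, invariance under
twisting by ANY nonzero integer `d` with `3 ∤ d`.  This file proves it at every odd place `v` with `v ∤ d`:

* (`f_v(W ⊗ d) = f_v(W)` is the LEAD's `conductorExponent_quadraticTwist_eq_of_not_dvd`, imported);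
* `kodairaSymbolAt_quadraticTwist_eq_of_not_dvd` — `K_v(W ⊗ d) = K_v(W)`;
* `hasAdditiveReductionAt_quadraticTwist_iff_of_not_dvd` (and `Good`, `Multiplicative`) — the reduction type;
* the `𝓞 ℚ`-place form `conductorExponent_quadraticTwist_eq_of_not_dvd'` and the factorisation form
  `factorization_conductorNorm_quadraticTwist_eq_of_not_dvd_odd` (`ord_q N(W ⊗ d) = ord_q N(W)` for odd `q ∤ d`);
* §3, the C3 reading at `v₃`: for `3 ∤ d` the binders «additive at 3», «`W ⊗ (−3)` additive at 3», `f₃`, `K₃` and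
  `j` of `W ⊗ d` are those of `W` (`coreBindersAtThree_quadraticTwist_of_not_dvd`; `(W ⊗ d) ⊗ (−3) = (W ⊗ (−3)) ⊗ d`
  literally, the LEAD's `quadraticTwist_negThree_comm`).

PROOF.  `W ⊗ d ≅ W.twistModel k`, `k = (d − 1)/4` (`exists_variableChange_twistModel_eq_quadraticTwist`); at an odd
place `v ∤ d`, `|4|_v = 1` so `|k|_v ≤ 1` and `|4k + 1|_v = |d|_v = 1`, whence the twist model is a `v`-integral
unramified twist: `conductorExponent_twistModel` / `kodairaSymbolAt_twistModel` (Comalada 1994 §2, Connell §4.3; tree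
`QuadraticTwistMinimalModelProofs`), and `f_v`, `K_v` are isomorphism invariants (`conductorExponent_smul'`,
`kodairaSymbolAt_smul'`).  The reduction type is read off `f_v` (`= 0 ⟺` good, `= 1 ⟺` multiplicative, `≥ 2 ⟺`
additive: `conductorExponent_eq_zero_iff_holds`, `…_eq_one_iff_holds`, `two_le_conductorExponent_iff_holds`).

HONEST FRAMING.  Folklore local bookkeeping (Silverman *ATAEC* IV.9.4; Connell §4.3), kernel-checked from the tree's Tate
algorithm; no law is touched.  C3, Manin's conjecture and BSD are NOT proved by anything here.  No definitions, no sorry,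
axioms standard.

[cite: SilvermanATAEC1994, IV.9.4 (PDF pp. 344–346) and Table 4.1 (a twist by a v-adic unit square class does not change the minimal model type at v)]
[cite: SilvermanAEC2009, X.5 Cor. 5.4 and App. C §16 (quadratic twists; the conductor)]
-/

set_option autoImplicit false
-- lint-debt: the directory name repeats the summit name (sibling precedent `ManinLocalTwoThreeGammaOneKatoRoad.lean`)
set_option linter.dupNamespace false

noncomputable section

open scoped Classical NumberField
open IsDedekindDomain IsDedekindDomain.HeightOneSpectrum Rat.HeightOneSpectrum
open WeierstrassCurve Literature.NumberTheory.DiophantineGeometry Literature.NumberTheory.EllipticCurves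

namespace Summit.BirchSwinnertonDyer.BirchSwinnertonDyer.Theorems.ManinLocalTwoThree

/-! ## §1 The unramified twist at an odd place of `ℤ` -/

section OddPlace

variable (W : WeierstrassCurve ℚ) [W.IsElliptic] {d : ℤ}
  (v : HeightOneSpectrum ℤ) (hv : natGenerator v ≠ 2) (hvd : ¬ (natGenerator v : ℤ) ∣ d)

omit [W.IsElliptic] in
include hvd in
/-- `v ∤ d ⟹ d ≠ 0`. -/
private theorem ne_zero_of_not_dvd : d ≠ 0 := by rintro rfl; exact hvd (dvd_zero _)

/-- `|4|_v = 1` at an odd place `v` of `ℤ`. -/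
private theorem valuation_four_eq_one (v : HeightOneSpectrum ℤ) (hv : natGenerator v ≠ 2) :
    v.valuation ℚ (4 : ℚ) = 1 := by
  have hgen : (natGenerator v).Prime := prime_natGenerator v
  rw [show (4 : ℚ) = ((4 : ℤ) : ℚ) by norm_num,
    Literature.NumberTheory.EllipticCurves.Rat.valuation_intCast_eq_one_iff]
  intro h
  have h2 : (natGenerator v : ℤ) ∣ 2 ^ 2 := by simpa using h
  have h2' : (natGenerator v : ℤ) ∣ 2 := (Nat.prime_iff_prime_int.mp hgen).dvd_of_dvd_pow h2
  have h2'' : natGenerator v ∣ 2 := by exact_mod_cast h2'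
  exact hv ((Nat.prime_dvd_prime_iff_eq hgen Nat.prime_two).mp h2'')

include hv hvd in
/-- **The unramified twist as a `v`-integral twist model.**  For `d ≠ 0`, `v` odd, `v ∤ d`: with `k = (d − 1)/4` one has
`|k|_v ≤ 1`, `|4k + 1|_v = 1`, `4k + 1 = d`, and `W ⊗ d = C • W.twistModel k` for a change of variables `C` over `ℚ`
(`exists_variableChange_twistModel_eq_quadraticTwist`); the twist model is elliptic. [folklore] -/
theorem exists_twistModel_of_not_dvd :
    ∃ (k : ℚ) (C : VariableChange ℚ), v.valuation ℚ k ≤ 1 ∧ v.valuation ℚ (4 * k + 1) = 1 ∧ 4 * k + 1 = (d : ℚ) ∧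
      C • W.twistModel k = W.quadraticTwist (d : ℚ) ∧ (W.twistModel k).IsElliptic := by
  have hd : d ≠ 0 := ne_zero_of_not_dvd v hvd
  have hd0 : (d : ℚ) ≠ 0 := by exact_mod_cast hd
  have hdv : v.valuation ℚ (d : ℚ) = 1 := by
    rw [Literature.NumberTheory.EllipticCurves.Rat.valuation_intCast_eq_one_iff]; exact hvd
  set k : ℚ := ((d : ℚ) - 1) / 4 with hk_def
  have hk4 : 4 * k + 1 = (d : ℚ) := by rw [hk_def]; ring
  have hkv : v.valuation ℚ k ≤ 1 := by
    rw [hk_def, map_div₀, valuation_four_eq_one v hv, div_one,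
      show ((d : ℚ) - 1) = algebraMap ℤ ℚ (d - 1) by rw [eq_intCast]; push_cast; ring]
    exact HeightOneSpectrum.valuation_le_one v (d - 1)
  have hk1 : v.valuation ℚ (4 * k + 1) = 1 := by rw [hk4]; exact hdv
  obtain ⟨C, -, hC⟩ := exists_variableChange_twistModel_eq_quadraticTwist W k
  rw [hk4] at hC
  have hell : (W.twistModel k).IsElliptic := by
    refine ⟨?_⟩
    rw [twistModel_Δ, hk4]
    exact (IsUnit.mk0 _ (pow_ne_zero 6 hd0)).mul W.isUnit_Δ
  exact ⟨k, C, hkv, hk1, hk4, hC, hell⟩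

include hv hvd in
/-- **`K_v(W ⊗ d) = K_v(W)`: the Kodaira symbol at an odd place `v ∤ d` is unchanged by the twist** (`kodairaSymbolAt_twistModel`,
`kodairaSymbolAt_smul'`). [cite: SilvermanATAEC1994, IV.9.4 and Table 4.1] -/
theorem kodairaSymbolAt_quadraticTwist_eq_of_not_dvd :
    (W.quadraticTwist (d : ℚ)).kodairaSymbolAt v = W.kodairaSymbolAt v := by
  haveI := W.isElliptic_quadraticTwist (show ((d : ℚ)) ≠ 0 by exact_mod_cast ne_zero_of_not_dvd v hvd)
  obtain ⟨k, C, hkv, hk1, -, hC, hell⟩ := exists_twistModel_of_not_dvd W v hv hvd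
  haveI := hell
  rw [← hC, kodairaSymbolAt_smul']
  exact kodairaSymbolAt_twistModel v W hkv hk1

include hv hvd in
/-- **Additive reduction at an odd place `v ∤ d` is unchanged by the twist** (`f_v ≥ 2 ⟺` additive,
`two_le_conductorExponent_iff_holds`). [cite: SilvermanATAEC1994, IV.10.2] -/
theorem hasAdditiveReductionAt_quadraticTwist_iff_of_not_dvd :
    (W.quadraticTwist (d : ℚ)).HasAdditiveReductionAt v ↔ W.HasAdditiveReductionAt v := by
  haveI := W.isElliptic_quadraticTwist (show ((d : ℚ)) ≠ 0 by exact_mod_cast ne_zero_of_not_dvd v hvd)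
  rw [← (W.quadraticTwist (d : ℚ)).two_le_conductorExponent_iff_holds v, ← W.two_le_conductorExponent_iff_holds v,
    conductorExponent_quadraticTwist_eq_of_not_dvd W v hv d hvd]

include hv hvd in
/-- **Good reduction at an odd place `v ∤ d` is unchanged by the twist** (`f_v = 0 ⟺` good, `conductorExponent_eq_zero_iff_holds`).
[cite: SilvermanATAEC1994, IV.10.2] -/
theorem hasGoodReductionAt_quadraticTwist_iff_of_not_dvd :
    (W.quadraticTwist (d : ℚ)).HasGoodReductionAt v ↔ W.HasGoodReductionAt v := by
  haveI := W.isElliptic_quadraticTwist (show ((d : ℚ)) ≠ 0 by exact_mod_cast ne_zero_of_not_dvd v hvd)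
  rw [← (W.quadraticTwist (d : ℚ)).conductorExponent_eq_zero_iff_holds v, ← W.conductorExponent_eq_zero_iff_holds v,
    conductorExponent_quadraticTwist_eq_of_not_dvd W v hv d hvd]

include hv hvd in
/-- **Multiplicative reduction at an odd place `v ∤ d` is unchanged by the twist** (`f_v = 1 ⟺` multiplicative,
`conductorExponent_eq_one_iff_holds`). [cite: SilvermanATAEC1994, IV.10.2] -/
theorem hasMultiplicativeReductionAt_quadraticTwist_iff_of_not_dvd :
    (W.quadraticTwist (d : ℚ)).HasMultiplicativeReductionAt v ↔ W.HasMultiplicativeReductionAt v := by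
  haveI := W.isElliptic_quadraticTwist (show ((d : ℚ)) ≠ 0 by exact_mod_cast ne_zero_of_not_dvd v hvd)
  rw [← (W.quadraticTwist (d : ℚ)).conductorExponent_eq_one_iff_holds v, ← W.conductorExponent_eq_one_iff_holds v,
    conductorExponent_quadraticTwist_eq_of_not_dvd W v hv d hvd]

/-- **Factorisation currency: `ord_q N(W ⊗ d) = ord_q N(W)` for an odd prime `q ∤ d`** (`N = ∏ p ^ f_p`,
`factorization_conductorNorm_holds`).  The tree's `factorization_conductorNorm_quadraticTwist_eq_of_not_dvd` is the case
`d ≡ 1 (mod 4)` (there also at `q = 2`); here `d` is arbitrary and `q` odd. [cite: SilvermanAEC2009, App. C §16] -/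
theorem factorization_conductorNorm_quadraticTwist_eq_of_not_dvd_odd {d : ℤ} {q : ℕ} (hq : q.Prime)
    (hq2 : q ≠ 2) (hqd : ¬ (q : ℤ) ∣ d) :
    (haveI := W.isElliptic_quadraticTwist (show ((d : ℚ)) ≠ 0 by
        exact_mod_cast (show d ≠ 0 by rintro rfl; exact hqd (dvd_zero _)));
      ((W.quadraticTwist (d : ℚ)).conductorNorm ℤ).factorization q) = (W.conductorNorm ℤ).factorization q := by
  haveI := W.isElliptic_quadraticTwist (show ((d : ℚ)) ≠ 0 by
    exact_mod_cast (show d ≠ 0 by rintro rfl; exact hqd (dvd_zero _)))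
  set v : HeightOneSpectrum ℤ := (primesEquiv (R := ℤ)).symm ⟨q, hq⟩ with hvdef
  have hgen : natGenerator v = q := congrArg Subtype.val ((primesEquiv (R := ℤ)).apply_symm_apply ⟨q, hq⟩)
  have h1 := factorization_conductorNorm_holds (W.quadraticTwist (d : ℚ)) v
  have h2 := factorization_conductorNorm_holds W v
  rw [hgen] at h1 h2
  rw [h1, h2]
  exact conductorExponent_quadraticTwist_eq_of_not_dvd W v (by rw [hgen]; exact hq2) d (by rw [hgen]; exact hqd)

end OddPlace

/-! ## §2 The same at a place of `𝓞 ℚ` -/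

/-- **`f_v(W ⊗ d) = f_v(W)` at an odd place `v` of `𝓞 ℚ` with `v ∤ d`** (the `𝓞 ℚ`-versus-`ℤ` bridge
`conductorExponent_eq_of_primesEquiv_eq`). [cite: SilvermanATAEC1994, IV.9.4 (PDF pp. 344–346)] -/
theorem conductorExponent_quadraticTwist_eq_of_not_dvd' (W : WeierstrassCurve ℚ) [W.IsElliptic] {d : ℤ}
    (v : HeightOneSpectrum (𝓞 ℚ)) (hv : (primesEquiv v : ℕ) ≠ 2) (hvd : ¬ ((primesEquiv v : ℕ) : ℤ) ∣ d) :
    (W.quadraticTwist (d : ℚ)).conductorExponent v = W.conductorExponent v := by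
  haveI := W.isElliptic_quadraticTwist (show ((d : ℚ)) ≠ 0 by
    exact_mod_cast (show d ≠ 0 by rintro rfl; exact hvd (dvd_zero _)))
  set v₀ : HeightOneSpectrum ℤ := (primesEquiv (R := ℤ)).symm (primesEquiv v) with hv₀
  have hvv : (primesEquiv v₀ : Nat.Primes) = primesEquiv v := by rw [hv₀, Equiv.apply_symm_apply]
  have hgen : natGenerator v₀ = (primesEquiv v : ℕ) := congrArg Subtype.val hvv
  rw [← WeierstrassCurve.conductorExponent_eq_of_primesEquiv_eq v₀ v (W.quadraticTwist (d : ℚ)) hvv,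
    ← WeierstrassCurve.conductorExponent_eq_of_primesEquiv_eq v₀ v W hvv]
  exact conductorExponent_quadraticTwist_eq_of_not_dvd W v₀ (by rw [hgen]; exact hv) d (by rw [hgen]; exact hvd)

/-! ## §3 The C3 reading: coprime-to-3 twists keep the core binders at `3` -/

/-- **THE C3 CORE BINDERS ARE INVARIANT UNDER COPRIME-TO-3 TWISTS.**  Let `v₃` be the place of `ℤ` above `3`, `d ≠ 0` with
`3 ∤ d`.  Then, for `W ⊗ d` versus `W`: the same `f₃`, the same Kodaira symbol at `3`, the same `j`, additive at `3` iff,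
and `(W ⊗ d) ⊗ (−3)` additive at `3` iff `W ⊗ (−3)` is (the latter pair are `(W ⊗ (−3d))` resp. twists of each other by `d`).
This is the transport of p2's C3 core `{ord₃ j > 0} ∩ {K₃ pot. good} ∩ {W ⊗ (−3) additive}` along the coprime twist partners
`A ⊗ q*`, `q ≠ 2, 3`, of `noRationalThreeTorsionOrbitMinimalResidual_of_coprimeIsolated` (C3 LEAD memo v20 §5 (iii)).
[cite: SilvermanATAEC1994, IV.9.4 and Table 4.1] -/
theorem coreBindersAtThree_quadraticTwist_of_not_dvd (W : WeierstrassCurve ℚ) [W.IsElliptic] {d : ℤ}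
    (h3d : ¬ (3 : ℤ) ∣ d) :
    haveI := W.isElliptic_quadraticTwist (show ((d : ℚ)) ≠ 0 by
      exact_mod_cast (show d ≠ 0 by rintro rfl; exact h3d (dvd_zero _)))
    ((W.quadraticTwist (d : ℚ)).conductorExponent ((primesEquiv (R := ℤ)).symm ⟨3, Nat.prime_three⟩) =
        W.conductorExponent ((primesEquiv (R := ℤ)).symm ⟨3, Nat.prime_three⟩)) ∧
      ((W.quadraticTwist (d : ℚ)).kodairaSymbolAt ((primesEquiv (R := ℤ)).symm ⟨3, Nat.prime_three⟩) =
        W.kodairaSymbolAt ((primesEquiv (R := ℤ)).symm ⟨3, Nat.prime_three⟩)) ∧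
      ((W.quadraticTwist (d : ℚ)).j = W.j) ∧
      ((W.quadraticTwist (d : ℚ)).HasAdditiveReductionAt ((primesEquiv (R := ℤ)).symm ⟨3, Nat.prime_three⟩) ↔
        W.HasAdditiveReductionAt ((primesEquiv (R := ℤ)).symm ⟨3, Nat.prime_three⟩)) ∧
      (((W.quadraticTwist (d : ℚ)).quadraticTwist ((-3 : ℤ) : ℚ)).HasAdditiveReductionAt
          ((primesEquiv (R := ℤ)).symm ⟨3, Nat.prime_three⟩) ↔
        (W.quadraticTwist ((-3 : ℤ) : ℚ)).HasAdditiveReductionAt ((primesEquiv (R := ℤ)).symm ⟨3, Nat.prime_three⟩)) := by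
  have hd : d ≠ 0 := by rintro rfl; exact h3d (dvd_zero _)
  haveI := W.isElliptic_quadraticTwist (show ((d : ℚ)) ≠ 0 by exact_mod_cast hd)
  haveI := W.isElliptic_quadraticTwist (show (((-3 : ℤ) : ℚ)) ≠ 0 by norm_num)
  set v : HeightOneSpectrum ℤ := (primesEquiv (R := ℤ)).symm ⟨3, Nat.prime_three⟩ with hvdef
  have hgen : natGenerator v = 3 := congrArg Subtype.val ((primesEquiv (R := ℤ)).apply_symm_apply ⟨3, Nat.prime_three⟩)
  have hv : natGenerator v ≠ 2 := by rw [hgen]; decide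
  have hvd : ¬ (natGenerator v : ℤ) ∣ d := by rw [hgen]; exact_mod_cast h3d
  refine ⟨conductorExponent_quadraticTwist_eq_of_not_dvd W v hv d hvd,
    kodairaSymbolAt_quadraticTwist_eq_of_not_dvd W v hv hvd,
    W.j_quadraticTwist (show ((d : ℚ)) ≠ 0 by exact_mod_cast hd),
    hasAdditiveReductionAt_quadraticTwist_iff_of_not_dvd W v hv hvd, ?_⟩
  rw [quadraticTwist_negThree_comm]
  exact hasAdditiveReductionAt_quadraticTwist_iff_of_not_dvd (W.quadraticTwist ((-3 : ℤ) : ℚ)) v hv hvd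

end Summit.BirchSwinnertonDyer.BirchSwinnertonDyer.Theorems.ManinLocalTwoThree

end
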